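import Mathlib.Analysis.SpecialFunctions.Gaussian.GaussianIntegral
import Mathlib.Analysis.SpecialFunctions.Trigonometric.Series
import HarnessLib

/-!
# The modified Bessel function of the second kind `K_ν(z)` (Macdonald function)

The definition used by Bateman–Grosswald for the Fourier (Chowla–Selberg) expansion of the
Epstein zeta function: "the Bessel function defined for arbitrary `ν` and `|arg z| < π/2` by
`K_ν(z) = ½ ∫₀^∞ e^{−z(u + u⁻¹)/2} u^{ν−1} du = ½ ∫_{−∞}^{∞} e^{−z cosh t} e^{νt} dt
= ∫₀^∞ e^{−z cosh t} cosh νt dt`" (Acta Arith. 9 (1964), §1 (2); Watson, *A Treatise on the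
Theory of Bessel Functions*, §6.22 (5); DLMF 10.32.9). We take the last integral as the
definition, for complex order `ν` and complex argument `z` (it converges absolutely for
`Re z > 0`; elsewhere the Bochner integral returns the junk value `0`, which is never used), and
prove the evident symmetry `K_{−ν} = K_ν`, realness for real data, and absolute convergence for
`Re z > 0` and every `ν` (`integrable_besselKIntegrand`: `cosh t ≥ 1 + t²/2` and
`|cosh νt| ≤ e^{|Re ν||t|}` give a Gaussian majorant), so that no junk value occurs in the uses
`K_{s−½}(2πkn)`, `k > 0`, `n ≥ 1`, `s ∈ ℂ` arbitrary.

What is NOT here: the alternative integral representations (Bateman–Grosswald Lemma 1,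
(12)–(13)), the bounds of their Lemmas 2–3, analyticity in `ν`, asymptotics. These are vendored as
named facts where used (`Literature/Barriers/RiemannHypothesis/EpsteinZetaBatemanGrosswald.lean`).

## Mathlib

Mathlib (pinned) has no Bessel functions (`Literature/Analysis/FunctionSpaces/BesselJ.lean`
defines `J_n` for `n : ℕ`); `Real.cosh`, `Complex.cosh`, `Complex.exp`, set integrals are Mathlib's.

## References

* [BatemanGrosswald1964] P. T. Bateman, E. Grosswald, *On Epstein's zeta function*, Acta Arith. 9
  (1964) 365–373, §1 (2).
-/

noncomputable section

open MeasureTheory Set Real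

namespace Literature.Analysis.FunctionSpaces

/-- The integrand `e^{−z cosh t} cosh(νt)` of the Macdonald function. [cite: BatemanGrosswald1964, §1 (2)] -/
def besselKIntegrand (ν z : ℂ) (t : ℝ) : ℂ :=
  Complex.exp (-z * (Real.cosh t : ℂ)) * Complex.cosh (ν * t)

/-- **The modified Bessel function of the second kind** `K_ν(z) = ∫₀^∞ e^{−z cosh t} cosh(νt) dt`
(complex order `ν`, complex argument `z`; absolutely convergent for `Re z > 0`, junk `0` where the
integral diverges). [cite: BatemanGrosswald1964, §1 (2)] -/
def besselK (ν z : ℂ) : ℂ :=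
  ∫ t in Ioi (0 : ℝ), besselKIntegrand ν z t

/-- Unfolding lemma. [folklore] -/
theorem besselK_def (ν z : ℂ) :
    besselK ν z = ∫ t in Ioi (0 : ℝ), Complex.exp (-z * (Real.cosh t : ℂ)) * Complex.cosh (ν * t) :=
  rfl

/-- `K_{−ν}(z) = K_ν(z)` ("`K_{−ν}(z) = K_ν(z)` by (2)", Bateman–Grosswald, proof of Lemma 2).
[cite: BatemanGrosswald1964, §2 Lemma 2] -/
theorem besselK_neg (ν z : ℂ) : besselK (-ν) z = besselK ν z := by
  unfold besselK besselKIntegrand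
  simp [neg_mul, Complex.cosh_neg]

/-- For real order and real argument the integrand is real. [folklore] -/
theorem besselKIntegrand_ofReal (ν x t : ℝ) :
    besselKIntegrand ν x t = ((Real.exp (-x * Real.cosh t) * Real.cosh (ν * t) : ℝ) : ℂ) := by
  unfold besselKIntegrand
  push_cast
  ring_nf

/-- `K_ν(x)` is real for real `ν` and real `x`. [folklore] -/
theorem besselK_ofReal (ν x : ℝ) :
    besselK ν x = ((∫ t in Ioi (0 : ℝ), Real.exp (-x * Real.cosh t) * Real.cosh (ν * t) : ℝ) : ℂ) := by
  unfold besselK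
  rw [setIntegral_congr_fun measurableSet_Ioi (fun t _ => besselKIntegrand_ofReal ν x t)]
  exact integral_ofReal

/-- The integrand is non-negative for real data. [folklore] -/
theorem besselKIntegrand_re_nonneg (ν x t : ℝ) :
    0 ≤ Real.exp (-x * Real.cosh t) * Real.cosh (ν * t) :=
  mul_nonneg (Real.exp_pos _).le (Real.cosh_pos _).le

/-- `|cosh(ν t)| ≤ e^{|Re ν| |t|}`. [folklore] -/
theorem norm_cosh_mul_le (ν : ℂ) (t : ℝ) : ‖Complex.cosh (ν * t)‖ ≤ Real.exp (|ν.re| * |t|) := by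
  have e : Complex.cosh (ν * t) = (Complex.exp (ν * t) + Complex.exp (-(ν * t))) / 2 := Complex.cosh.eq_1 _
  rw [e, norm_div, Complex.norm_two]
  have hb : ‖Complex.exp (ν * t) + Complex.exp (-(ν * t))‖ ≤
      Real.exp (|ν.re| * |t|) + Real.exp (|ν.re| * |t|) := by
    refine (norm_add_le _ _).trans (add_le_add ?_ ?_)
    · rw [Complex.norm_exp]
      apply Real.exp_le_exp.2
      simp only [Complex.mul_re, Complex.ofReal_re, Complex.ofReal_im, mul_zero, sub_zero]
      rw [← abs_mul]; exact le_abs_self _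
    · rw [Complex.norm_exp]
      apply Real.exp_le_exp.2
      simp only [Complex.neg_re, Complex.mul_re, Complex.ofReal_re, Complex.ofReal_im, mul_zero,
        sub_zero]
      rw [← abs_mul]; exact neg_le_abs _
  linarith

/-- **Absolute convergence for `Re z > 0`**: the integrand is dominated by the Gaussian
`e^{−Re z + (Re ν)²/Re z} · e^{−(Re z/4) t²}` (`cosh t ≥ 1 + t²/2`, `|cosh νt| ≤ e^{|Re ν| t}`,
`|Re ν| t ≤ (Re z/4) t² + (Re ν)²/Re z`). [folklore] -/
theorem integrable_besselKIntegrand {ν z : ℂ} (hz : 0 < z.re) :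
    Integrable (besselKIntegrand ν z) := by
  set x := z.re with hx
  set σ := |ν.re| with hσ
  have hσ0 : 0 ≤ σ := abs_nonneg _
  have hmaj : Integrable (fun t : ℝ => Real.exp (-x + σ ^ 2 / x) * Real.exp (-(x / 4) * t ^ 2)) :=
    (integrable_exp_neg_mul_sq (by positivity : 0 < x / 4)).const_mul _
  have hmeas : AEStronglyMeasurable (besselKIntegrand ν z) volume := by
    unfold besselKIntegrand
    exact (Continuous.aestronglyMeasurable (by fun_prop))
  refine Integrable.mono' hmaj hmeas (Filter.Eventually.of_forall fun t => ?_)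
  unfold besselKIntegrand
  rw [norm_mul, Complex.norm_exp]
  have h1 : (-z * (Real.cosh t : ℂ)).re = -(x * Real.cosh t) := by simp [Complex.mul_re, hx]
  rw [h1]
  -- `cosh t ≥ 1 + t²/2` (first two terms of the cosh series; cf.
  -- `Literature.Analysis.Complex.DeBruijn1950.one_add_sq_div_two_le_cosh`, not imported to keep this file light)
  have hc : 1 + t ^ 2 / 2 ≤ Real.cosh t := by
    have hle := sum_le_hasSum (Finset.range 2)
      (fun n _ => div_nonneg (by rw [pow_mul]; positivity) (Nat.cast_nonneg _)) (Real.hasSum_cosh t)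
    simpa [Finset.sum_range_succ, Nat.factorial] using hle
  have h2 : Real.exp (-(x * Real.cosh t)) ≤ Real.exp (-(x * (1 + t ^ 2 / 2))) := by
    apply Real.exp_le_exp.2; nlinarith
  have h3 := norm_cosh_mul_le ν t
  have h4 : σ * |t| ≤ x / 4 * t ^ 2 + σ ^ 2 / x := by
    have key : 0 ≤ x / 4 * (|t| - 2 * σ / x) ^ 2 := by positivity
    have e : x / 4 * (|t| - 2 * σ / x) ^ 2 = x / 4 * t ^ 2 - σ * |t| + σ ^ 2 / x := by
      field_simp
      rw [← sq_abs t]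
      ring
    linarith
  calc Real.exp (-(x * Real.cosh t)) * ‖Complex.cosh (ν * t)‖
      ≤ Real.exp (-(x * (1 + t ^ 2 / 2))) * Real.exp (σ * |t|) :=
        mul_le_mul h2 h3 (norm_nonneg _) (Real.exp_pos _).le
    _ ≤ Real.exp (-(x * (1 + t ^ 2 / 2))) * Real.exp (x / 4 * t ^ 2 + σ ^ 2 / x) :=
        mul_le_mul_of_nonneg_left (Real.exp_le_exp.2 h4) (Real.exp_pos _).le
    _ = Real.exp (-x + σ ^ 2 / x) * Real.exp (-(x / 4) * t ^ 2) := by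
        rw [← Real.exp_add, ← Real.exp_add]; ring_nf

/-- Absolute convergence of `K_ν(z) = ∫₀^∞ e^{−z cosh t} cosh(νt) dt` for `Re z > 0`. [folklore] -/
theorem integrableOn_besselKIntegrand {ν z : ℂ} (hz : 0 < z.re) :
    IntegrableOn (besselKIntegrand ν z) (Ioi 0) :=
  (integrable_besselKIntegrand (ν := ν) hz).integrableOn

/-- `K_ν(x) > 0` for real `ν` and `x > 0` (a convergent integral of a positive continuous
function). [folklore] -/
theorem besselK_ofReal_re_pos (ν : ℝ) {x : ℝ} (hx : 0 < x) : 0 < (besselK ν x).re := by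
  rw [besselK_ofReal, Complex.ofReal_re]
  have hint : IntegrableOn (fun t : ℝ => Real.exp (-x * Real.cosh t) * Real.cosh (ν * t)) (Ioi 0) := by
    have h := (integrable_besselKIntegrand (ν := (ν : ℂ)) (z := (x : ℂ)) (by simpa using hx)).norm
    refine (h.congr ?_).integrableOn
    exact Filter.Eventually.of_forall fun t => by
      simp only []
      rw [besselKIntegrand_ofReal, Complex.norm_real, Real.norm_eq_abs,
        abs_of_nonneg (besselKIntegrand_re_nonneg ν x t)]
  have hpos : ∀ t : ℝ, 0 < Real.exp (-x * Real.cosh t) * Real.cosh (ν * t) := fun t =>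
    mul_pos (Real.exp_pos _) (Real.cosh_pos _)
  rw [setIntegral_pos_iff_support_of_nonneg_ae (Filter.Eventually.of_forall fun t => (hpos t).le) hint]
  have hsupp : Function.support (fun t : ℝ => Real.exp (-x * Real.cosh t) * Real.cosh (ν * t)) = univ :=
    Function.support_eq_univ fun t => (hpos t).ne'
  rw [hsupp, univ_inter, Real.volume_Ioi]
  exact ENNReal.zero_lt_top
end Literature.Analysis.FunctionSpaces
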